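import Summits.ValiantsHypothesis.ValiantsHypothesis.Theorems.PolyaContinuedLaplaceRigiditySingCodimTools
import Mathlib.RingTheory.Localization.FractionRing
import Mathlib.RingTheory.MvPolynomial.Ideal

/-!
# Generic points: tools, part 2 (the kernel of a generic point, the two-sided bridge, support splits)

Helper file (no definitions, no `sorry`) for the structure theory of the top-dimensional components of
`Sing(per₄)` on line `laplace_rigidity` of crux `CoverDecancellation` (stmt-ValiantsHypothesis-17819,
rung row R3, width 4 / `str₂(per₄) ≥ 5`).  It complements `…SingCodimTools` (val-width-17819-w1 g0):

* `ker_aeval_quotient_mk_X` — for a prime `P ⊂ F[X_σ]` the point `x ↦ X_x mod P` of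
  `Frac(F[X_σ]/P)` has kernel exactly `P` (the GENERIC POINT of `V(P)`);
* `exists_height_ker_aeval_eq_add` — **the two-sided bridge**: for a point `z : ι → L`,
  `toNat (trdeg_F F[z]) + height (ker (f ↦ f(z))) = card ι` (catenary dimension formula
  `Literature.RingTheory.KrullDimension.ringKrullDim_quotient_add_height` and
  `…ringKrullDim_quotient_vanishingIdeal_singleton`; `…Tools.natCast_sub_le_height_ker_aeval` is its
  `≤` half), with the corollaries `natCast_le_trdeg_of_height_ker_aeval_le` (`height ≤ m ⇒ card - m ≤
  trdeg`) and `trdeg_adjoin_range_lt_aleph0`;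
* `trdeg_adjoin_range_le_of_aeval_eq_zero_fintype` — a non-trivial polynomial relation among the
  coordinates of `w : ι → L` drops `trdeg_F F[w]` to `≤ card ι - 1` (any finite index type);
* `exists_split_off_vars` — every polynomial splits as `f = g + r` with `r` in the ideal of the
  variables of `S` and `g` free of those variables (`g.vars ⊆ Sᶜ`, `g.support ⊆ f.support`), and
  `isHomogeneous_of_support_subset` — `g` inherits homogeneity from `f`.

Honest framing: dictionary/tool work; VP ≠ VNP is NOT proved and no summit statement is touched.
val-width-17819-w1 g2, 2026-08-28.  All [folklore].
-/

set_option linter.dupNamespace false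

noncomputable section

namespace Summit.ValiantsHypothesis.ValiantsHypothesis.Theorems.PolyaContinuedLaplaceRigidity.SingCodim

open MvPolynomial Cardinal

variable {F : Type*} [Field F] {L : Type*} [Field L] [Algebra F L]

/-! ### The generic point of a prime -/

/-- **Generic point.**  For a prime `P` of `F[X_σ]`, the point `x ↦ (X_x mod P)` with values in the
fraction field of `F[X_σ]/P` has kernel exactly `P`. [folklore] -/
theorem ker_aeval_quotient_mk_X {σ : Type*} (P : Ideal (MvPolynomial σ F)) [P.IsPrime] :
    RingHom.ker (aeval (R := F) (fun x : σ =>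
      algebraMap (MvPolynomial σ F ⧸ P) (FractionRing (MvPolynomial σ F ⧸ P))
        (Ideal.Quotient.mk P (X x)))) = P := by
  set Lf := FractionRing (MvPolynomial σ F ⧸ P)
  set z : σ → Lf := fun x => algebraMap (MvPolynomial σ F ⧸ P) Lf (Ideal.Quotient.mk P (X x))
    with hz
  have haeval : ∀ p : MvPolynomial σ F, aeval z p = algebraMap _ Lf (Ideal.Quotient.mk P p) := by
    intro p
    have h : (aeval (R := F) z : MvPolynomial σ F →ₐ[F] Lf) =
        (IsScalarTower.toAlgHom F (MvPolynomial σ F ⧸ P) Lf).comp (Ideal.Quotient.mkₐ F P) :=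
      MvPolynomial.algHom_ext fun x => by simp [hz]
    exact congrArg (fun φ : MvPolynomial σ F →ₐ[F] Lf => φ p) h
  ext p
  rw [RingHom.mem_ker, haeval, map_eq_zero_iff _ (IsFractionRing.injective _ _),
    Ideal.Quotient.eq_zero_iff_mem]

/-! ### The two-sided bridge -/

/-- `trdeg_F F[z]` is finite for a point with finitely many coordinates. [folklore] -/
theorem trdeg_adjoin_range_lt_aleph0 {ι : Type*} [Fintype ι] (z : ι → L) :
    Algebra.trdeg F (Algebra.adjoin F (Set.range z)) < ℵ₀ := by
  refine lt_of_le_of_lt (trdeg_adjoin_le_card_of_forall_alg (T := Set.range z)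
    fun x hx => alg_of_mem hx) ?_
  exact (Set.finite_range z).lt_aleph0

/-- **Two-sided bridge.**  For a point `z : ι → L` (`ι` finite, `L ⊇ F` a field):
`toNat (trdeg_F F[z]) + height (ker (f ↦ f(z))) = card ι`.  (`dim F[X]/P + height P = card ι` for
the prime `P = ker`, and `dim F[X]/P = trdeg_F F(z) = trdeg_F F[z]`.) [folklore] -/
theorem exists_height_ker_aeval_eq_add {ι : Type} [Fintype ι] (z : ι → L) :
    ∃ m : ℕ, (RingHom.ker (aeval (R := F) z)).height = m ∧
      Cardinal.toNat (Algebra.trdeg F (Algebra.adjoin F (Set.range z))) + m = Fintype.card ι := by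
  classical
  set P : Ideal (MvPolynomial ι F) := RingHom.ker (aeval (R := F) z) with hPdef
  haveI hP : P.IsPrime := RingHom.ker_isPrime _
  haveI : IsDomain (MvPolynomial ι F ⧸ P) := Ideal.Quotient.isDomain P
  haveI : Algebra.FiniteType F (MvPolynomial ι F ⧸ P) :=
    (inferInstance : Algebra.FiniteType F (MvPolynomial ι F)).of_surjective
      (Ideal.Quotient.mkₐ F P) Ideal.Quotient.mk_surjective
  -- catenary: `dim (F[X]/P) + height P = card ι`
  have hcat := Literature.RingTheory.KrullDimension.ringKrullDim_quotient_add_height (F := F) P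
  rw [MvPolynomial.ringKrullDim_of_isNoetherianRing, ringKrullDim_eq_zero_of_field F, zero_add,
    Nat.card_eq_fintype_card] at hcat
  -- `dim F[X]/P = trdeg F(z)`
  have hvan : vanishingIdeal F ({z} : Set (ι → L)) = P := by
    rw [hPdef, Literature.RingTheory.KrullDimension.vanishingIdeal_singleton_eq_ker]
  have hdim := Literature.RingTheory.KrullDimension.ringKrullDim_quotient_vanishingIdeal_singleton
    (k := F) z
  rw [hvan] at hdim
  rw [hdim] at hcat
  -- the height is finite
  have hfin : P.height ≠ ⊤ := Ideal.height_ne_top_of_isPrime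
  obtain ⟨m, hm⟩ := ENat.ne_top_iff_exists.1 hfin
  refine ⟨m, hm.symm, ?_⟩
  rw [← hm] at hcat
  have h1 : ((Cardinal.toNat (Algebra.trdeg F (IntermediateField.adjoin F (Set.range z))) +
      m : ℕ) : WithBot ℕ∞) = ((Fintype.card ι : ℕ) : WithBot ℕ∞) := by
    push_cast
    exact_mod_cast hcat
  have h2 : Cardinal.toNat (Algebra.trdeg F (IntermediateField.adjoin F (Set.range z))) + m =
      Fintype.card ι := by exact_mod_cast h1
  rwa [Literature.RingTheory.KrullDimension.trdeg_intermediateFieldAdjoin_eq] at h2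

/-- **Reverse bridge**: `height (ker (f ↦ f(z))) ≤ m` forces `card ι - m ≤ trdeg_F F[z]`.
[folklore] -/
theorem natCast_le_trdeg_of_height_ker_aeval_le {ι : Type} [Fintype ι] (z : ι → L) {m : ℕ}
    (hm : (RingHom.ker (aeval (R := F) z)).height ≤ m) :
    ((Fintype.card ι - m : ℕ) : Cardinal) ≤ Algebra.trdeg F (Algebra.adjoin F (Set.range z)) := by
  obtain ⟨m', hm', hsum⟩ := exists_height_ker_aeval_eq_add (F := F) z
  rw [hm'] at hm
  have hmm : m' ≤ m := by exact_mod_cast hm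
  have hle : Fintype.card ι - m ≤
      Cardinal.toNat (Algebra.trdeg F (Algebra.adjoin F (Set.range z))) := by omega
  calc ((Fintype.card ι - m : ℕ) : Cardinal)
      ≤ (Cardinal.toNat (Algebra.trdeg F (Algebra.adjoin F (Set.range z))) : Cardinal) := by
        exact_mod_cast hle
    _ = Algebra.trdeg F (Algebra.adjoin F (Set.range z)) :=
        Cardinal.cast_toNat_of_lt_aleph0 (trdeg_adjoin_range_lt_aleph0 z)

/-- **Reverse bridge, contrapositive form**: if `trdeg_F F[z] ≤ d` and `height (ker) ≤ m` then
`card ι ≤ d + m`. [folklore] -/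
theorem card_le_of_trdeg_le_of_height_le {ι : Type} [Fintype ι] (z : ι → L) {d m : ℕ}
    (hd : Algebra.trdeg F (Algebra.adjoin F (Set.range z)) ≤ d)
    (hm : (RingHom.ker (aeval (R := F) z)).height ≤ m) : Fintype.card ι ≤ d + m := by
  have h := (natCast_le_trdeg_of_height_ker_aeval_le (F := F) z hm).trans hd
  have h' : Fintype.card ι - m ≤ d := by exact_mod_cast h
  omega

/-! ### A relation drops the transcendence degree (any finite index type) -/

/-- **A non-trivial polynomial relation among the coordinates of `w : ι → L` drops `trdeg_F F[w]`
to at most `card ι - 1`** (reindex to `Fin (n+1)` and use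
`…Tools.trdeg_adjoin_range_le_of_aeval_eq_zero`). [folklore] -/
theorem trdeg_adjoin_range_le_of_aeval_eq_zero_fintype {ι : Type*} [Fintype ι] (w : ι → L)
    {P : MvPolynomial ι F} (hP : P ≠ 0) (hw : aeval w P = 0) :
    Algebra.trdeg F (Algebra.adjoin F (Set.range w)) ≤ (Fintype.card ι - 1 : ℕ) := by
  classical
  obtain ⟨n, ⟨e⟩⟩ : ∃ n, Nonempty (ι ≃ Fin n) := ⟨Fintype.card ι, ⟨Fintype.equivFin ι⟩⟩
  have hcard : Fintype.card ι = n := by simpa using Fintype.card_congr e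
  cases n with
  | zero =>
    -- no variables: `P` is a non-zero constant, contradiction
    haveI : IsEmpty ι := by
      rw [← Fintype.card_eq_zero_iff, hcard]
    obtain ⟨c, rfl⟩ := C_surjective ι P
    rw [aeval_C, map_eq_zero_iff _ (algebraMap F L).injective] at hw
    exact absurd (by rw [hw, C_0]) hP
  | succ m =>
    set w' : Fin (m + 1) → L := w ∘ e.symm with hw'
    have hP' : rename e P ≠ 0 := fun h =>
      hP (rename_injective e e.injective (by rw [h, map_zero]))
    have hwP' : aeval w' (rename e P) = 0 := by
      rw [aeval_rename, hw']
      have : (w ∘ ⇑e.symm) ∘ ⇑e = w := by ext x; simp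
      rw [this, hw]
    have h := trdeg_adjoin_range_le_of_aeval_eq_zero (F := F) w' hP' hwP'
    have hrange : Set.range w' = Set.range w := by
      rw [hw', e.symm.surjective.range_comp]
    rw [hrange] at h
    rw [hcard]
    simpa using h

/-! ### Splitting off the variables of a set -/

/-- **Support split.**  Every polynomial `f` is `g + r` with `r` in the ideal of the variables
`X_s, s ∈ S`, and `g` built from the monomials of `f` not involving any variable of `S`
(`g.vars ⊆ Sᶜ`, `g.support ⊆ f.support`). [folklore] -/
theorem exists_split_off_vars {σ : Type*} (S : Set σ) (f : MvPolynomial σ F) :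
    ∃ g r : MvPolynomial σ F, f = g + r ∧ r ∈ Ideal.span (X '' S) ∧ ↑g.vars ⊆ Sᶜ ∧
      g.support ⊆ f.support := by
  classical
  set p : (σ →₀ ℕ) → Prop := fun m => ∀ s ∈ S, m s = 0 with hp
  set g : MvPolynomial σ F := ∑ m ∈ f.support.filter p, monomial m (coeff m f) with hg
  have hcoeff : ∀ m, coeff m g = if p m then coeff m f else 0 := by
    intro m
    rw [hg, coeff_sum]
    simp only [coeff_monomial]
    by_cases hm : p m
    · rw [if_pos hm]
      by_cases hmf : m ∈ f.support
      · rw [Finset.sum_eq_single m]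
        · rw [if_pos rfl]
        · intro b _ hb; rw [if_neg hb]
        · intro h; exact absurd (Finset.mem_filter.2 ⟨hmf, hm⟩) h
      · rw [Finset.sum_eq_zero]
        · exact (notMem_support_iff.1 hmf).symm
        · intro b hb
          rw [if_neg]
          rintro rfl
          exact hmf (Finset.mem_filter.1 hb).1
    · rw [if_neg hm]
      refine Finset.sum_eq_zero fun b hb => ?_
      rw [if_neg]
      rintro rfl
      exact hm (Finset.mem_filter.1 hb).2
  refine ⟨g, f - g, (add_sub_cancel g f).symm, ?_, ?_, ?_⟩
  · -- `f - g` lies in the ideal of the `S`-variables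
    rw [mem_ideal_span_X_image]
    intro m hm
    rw [mem_support_iff, coeff_sub, hcoeff] at hm
    by_cases hpm : p m
    · rw [if_pos hpm, sub_self] at hm
      exact absurd rfl hm
    · simp only [hp, not_forall] at hpm
      obtain ⟨s, hs, hms⟩ := hpm
      exact ⟨s, hs, hms⟩
  · -- `g` involves no `S`-variable
    intro v hv
    rw [Finset.mem_coe, mem_vars_iff_mem_support] at hv
    obtain ⟨m, hm, hvm⟩ := hv
    rw [mem_support_iff, hcoeff] at hm
    by_cases hpm : p m
    · intro hvS
      rw [Finsupp.mem_support_iff] at hvm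
      exact hvm (hpm v hvS)
    · rw [if_neg hpm] at hm
      exact absurd rfl hm
  · intro m hm
    rw [mem_support_iff, hcoeff] at hm
    by_cases hpm : p m
    · rw [if_pos hpm] at hm
      exact mem_support_iff.2 hm
    · rw [if_neg hpm] at hm
      exact absurd rfl hm

/-- A polynomial whose support lies in that of a homogeneous polynomial is homogeneous of the same
degree. [folklore] -/
theorem isHomogeneous_of_support_subset {σ : Type*} {f g : MvPolynomial σ F} {n : ℕ}
    (hf : f.IsHomogeneous n) (hg : g.support ⊆ f.support) : g.IsHomogeneous n := by
  intro m hm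
  exact hf (mem_support_iff.1 (hg (mem_support_iff.2 hm)))

/-- Pulling a polynomial in the variables of `range g` back along the injection `g` preserves
homogeneity. [folklore] -/
theorem exists_rename_eq_of_vars_subset_range_isHomogeneous {σ τ : Type*} (f : MvPolynomial σ F)
    (g : τ → σ) (hg : Function.Injective g) (hvars : ↑f.vars ⊆ Set.range g) {n : ℕ}
    (hf : f.IsHomogeneous n) :
    ∃ q : MvPolynomial τ F, rename g q = f ∧ q.IsHomogeneous n := by
  obtain ⟨q, hq⟩ := exists_rename_eq_of_vars_subset_range f g hg hvars
  refine ⟨q, hq, ?_⟩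
  rw [← IsHomogeneous.rename_isHomogeneous_iff hg, hq]
  exact hf

end Summit.ValiantsHypothesis.ValiantsHypothesis.Theorems.PolyaContinuedLaplaceRigidity.SingCodim

end
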